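import Summits.HodgeConjecture.HodgeConjecture.Theorems.Ring2WeilCoverageCMFieldBiquadraticIntegerClasses
import Summits.HodgeConjecture.HodgeConjecture.Theorems.Ring2WeilCoverageCMFieldRationalPrimeRuleInstancesIII
import HarnessLib

/-!
# Ring 2 — Weil-family coverage, CM-field rows: THE INTEGER ROWS `W8.E.[n]` of the biquadratic b03.29 tables, II — the `ℚ(ζ₄₀)`-fields
  (WEIL-FAMILY-COVERAGE «## b03», cell (xxi⁵), part 30)

research route conditional on HC_CM; not a corollary; Q11.4-sentence-2 already refuted in dim ≥ 3.

On Deligne's carrier `R = S² + pS + q` (`F = ℚ(θ)`, `E = F(√θ)`, classes `[n] ∈ F^×/Nm_{E/F}(E^×)` labelled by their `T`-sets)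
[cite: Deligne1982HodgeCycles, §4 p. 30, (1), Cor. 4.2] the biquadratic b03.29 fields `E = F(√b₀)` have their PRIMES
classified by parts 16–19 (`[ℓ] ≠ [1] ⟺ ℓ` in explicit classes mod `24 ∕ 40 ∕ 60`; every prime dividing `2·disc·b₀` is a
norm).  Part IX-M's `natCast_eq_split_iff_even` turns this into the classification of ALL integer rows once each non-split
prime obstructs with a cofactor (`[ℓ·w] ≠ [1]`, `ℓ ∤ w`) — supplied by the cofactor transfer of part 29 (§72).  This file: §77–§80 the
four `ℚ(ζ₄₀)`-fields `ℚ(i,√10)`, `ℚ(√-5,√2)`, `ℚ(√-2,√5)`, `ℚ(√-2,√-5)`: **`[n] = [1] ⟺` every non-split prime divides `n`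
to an even power; `[n₁] = [n₂] ⟺` equal parities.**
No new definition, no named fact, no sorry; nothing about the Hodge conjecture is asserted (index-set bookkeeping only).
-/

noncomputable section

set_option linter.dupNamespace false

open Polynomial NumberField IsDedekindDomain

namespace Summit.HodgeConjecture.HodgeConjecture.Ring2.WeilCoverageCM

open Literature.AlgebraicGeometry.Deligne1982
open Literature.AlgebraicGeometry.HodgeTheory (splitDiscriminantClassCM)
open Literature.NumberTheory.QuadraticForms

variable {R : Polynomial ℤ} [Fact (Irreducible (cmPolyQ R))] [Fact (Irreducible (realPolyQ R))]

/-! ### §77 `E = ℚ(i,√10)` (`R = S² + 22S + 81`, `F = ℚ(√10)`): non-split primes `ℓ % 40 = 3 ∨ ℓ % 40 = 27 ∨ ℓ % 40 = 31 ∨ ℓ % 40 = 39` -/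
section IsqrtNeg1Sqrt10
/-- **Cofactor obstruction for `ℚ(i,√10)`**: for every non-split prime `ℓ` (`ℓ % 40 = 3 ∨ ℓ % 40 = 27 ∨ ℓ % 40 = 31 ∨ ℓ % 40 = 39`) and every `w ∈ ℤ` with
`ℓ ∤ w`: `[ℓ·w] ≠ [(-1)^k]` (`k` even) — the inert degree-one place over `ℓ` of part 12 has `ord_v(ℓw) = ord_v ℓ` odd.
[cite: Deligne1982HodgeCycles, §4 (1) and Cor. 4.2] [cite: Omeara1963, §63B Example 63:12 and §71D Thm. 71:18] -/
theorem sqrtNeg1Sqrt10_mk_natCast_mul_ne_splitDiscriminantClassCM (hR : R = X ^ 2 + C 22 * X + C 81) {ℓ : ℕ} (hℓ : ℓ.Prime)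
    (hS : ℓ % 40 = 3 ∨ ℓ % 40 = 27 ∨ ℓ % 40 = 31 ∨ ℓ % 40 = 39) {w : ℤ} (hw : ¬ (ℓ : ℤ) ∣ w) (qℓ : (realField R)ˣ)
    (hqℓ : (qℓ : realField R) = (ℓ : realField R) * (w : realField R)) {k : ℕ} (hk : Even k) :
    (QuotientGroup.mk qℓ : cmNormResidueGroup R) ≠ splitDiscriminantClassCM R k := by
  haveI := Fact.mk hℓ
  have hroots := roots_real_neg_of_quadratic hR (by norm_num) (by norm_num) (by norm_num)
  have hrel := root_rel_quadratic hR
  push_cast at hrel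
  have hℓ0 : (ℓ : realField R) ≠ 0 := by exact_mod_cast hℓ.ne_zero
  have hne := (sqrtNeg1Sqrt10_mk_prime_ne_splitDiscriminantClassCM_iff_mod hR hℓ (Units.mk0 _ hℓ0) (Units.val_mk0 _)
    even_two).2 hS
  have hfac : AdjoinRoot.root (realPolyQ R) = -((-9/2 : realField R) + (-1/2 : realField R) * AdjoinRoot.root (realPolyQ R)) ^ 2 := by
    linear_combination (1/4 : realField R) * hrel
  exact mk_natCast_mul_ne_splitDiscriminantClassCM_of_ne_of_root_eq_neg_sq hroots hfac (sqrtNeg1Sqrt10_ratPrimeRule_dyadic_unique hR)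
    hℓ (Units.mk0 _ hℓ0) (Units.val_mk0 _) even_two hne hw qℓ hqℓ hk

/-- **THE INTEGER ROWS of the `ℚ(i,√10)` table**: for `n ≥ 1`, **`[n] = [1] ⟺` every prime `ℓ` with `ℓ % 40 = 3 ∨ ℓ % 40 = 27 ∨ ℓ % 40 = 31 ∨ ℓ % 40 = 39` divides `n`
to an EVEN power** (part IX-M's induction; no exceptional prime). [cite: Deligne1982HodgeCycles, §4 (1) and Cor. 4.2]
[cite: Landherr1936HermitianForms] -/
theorem sqrtNeg1Sqrt10_natCast_eq_splitDiscriminantClassCM_iff (hR : R = X ^ 2 + C 22 * X + C 81) (n : ℕ) (hn : 1 ≤ n)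
    (v : (realField R)ˣ) (hv : (v : realField R) = n) :
    (QuotientGroup.mk v : cmNormResidueGroup R) = splitDiscriminantClassCM R 2 ↔
      ∀ ℓ : ℕ, ℓ.Prime → (ℓ % 40 = 3 ∨ ℓ % 40 = 27 ∨ ℓ % 40 = 31 ∨ ℓ % 40 = 39) → Even (n.factorization ℓ) := by
  refine (natCast_eq_split_iff_even (fun ℓ ↦ ¬ (ℓ % 40 = 3 ∨ ℓ % 40 = 27 ∨ ℓ % 40 = 31 ∨ ℓ % 40 = 39)) 1 ?_ (fun h ↦ absurd h Nat.not_prime_one) ?_ n hn v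
    hv).trans (forall_congr' fun ℓ ↦ forall_congr' fun _ ↦ by simp only [not_not])
  · intro ℓ hℓ hs u hu
    by_contra hne
    exact hs ((sqrtNeg1Sqrt10_mk_prime_ne_splitDiscriminantClassCM_iff_mod hR hℓ u hu even_two).1 hne)
  · intro ℓ hℓ hs _ w hw u hu
    exact sqrtNeg1Sqrt10_mk_natCast_mul_ne_splitDiscriminantClassCM hR hℓ (not_not.1 hs) hw u
      (by rw [hu, map_mul, map_natCast, map_intCast]) even_two

/-- **ROW STRUCTURE of the `ℚ(i,√10)` table**: `[n₁] = [n₂] ⟺` the primes `ℓ` with `ℓ % 40 = 3 ∨ ℓ % 40 = 27 ∨ ℓ % 40 = 31 ∨ ℓ % 40 = 39` occur in `n₁`, `n₂` with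
exponents of the same parity. [cite: Deligne1982HodgeCycles, §4 (1) and Cor. 4.2] [cite: Landherr1936HermitianForms] -/
theorem sqrtNeg1Sqrt10_natCast_mk_eq_mk_iff (hR : R = X ^ 2 + C 22 * X + C 81) {n₁ n₂ : ℕ} (hn₁ : 1 ≤ n₁) (hn₂ : 1 ≤ n₂)
    (u v : (realField R)ˣ) (hu : (u : realField R) = n₁) (hv : (v : realField R) = n₂) :
    (QuotientGroup.mk u : cmNormResidueGroup R) = QuotientGroup.mk v ↔
      ∀ ℓ : ℕ, ℓ.Prime → (ℓ % 40 = 3 ∨ ℓ % 40 = 27 ∨ ℓ % 40 = 31 ∨ ℓ % 40 = 39) → (Even (n₁.factorization ℓ) ↔ Even (n₂.factorization ℓ)) := by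
  refine (natCast_mk_eq_mk_iff_even (fun ℓ ↦ ¬ (ℓ % 40 = 3 ∨ ℓ % 40 = 27 ∨ ℓ % 40 = 31 ∨ ℓ % 40 = 39)) 1 ?_ (fun h ↦ absurd h Nat.not_prime_one) ?_ hn₁ hn₂
    u v hu hv).trans (forall_congr' fun ℓ ↦ forall_congr' fun _ ↦ by simp only [not_not])
  · intro ℓ hℓ hs u hu
    by_contra hne
    exact hs ((sqrtNeg1Sqrt10_mk_prime_ne_splitDiscriminantClassCM_iff_mod hR hℓ u hu even_two).1 hne)
  · intro ℓ hℓ hs _ w hw u hu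
    exact sqrtNeg1Sqrt10_mk_natCast_mul_ne_splitDiscriminantClassCM hR hℓ (not_not.1 hs) hw u
      (by rw [hu, map_mul, map_natCast, map_intCast]) even_two

end IsqrtNeg1Sqrt10

/-! ### §78 `E = ℚ(√-5,√2)` (`R = S² + 30S + 25`, `F = ℚ(√2)`): non-split primes `ℓ % 40 = 17 ∨ ℓ % 40 = 31 ∨ ℓ % 40 = 33 ∨ ℓ % 40 = 39` -/
section IsqrtNeg5Sqrt2
/-- **Cofactor obstruction for `ℚ(√-5,√2)`**: for every non-split prime `ℓ` (`ℓ % 40 = 17 ∨ ℓ % 40 = 31 ∨ ℓ % 40 = 33 ∨ ℓ % 40 = 39`) and every `w ∈ ℤ` with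
`ℓ ∤ w`: `[ℓ·w] ≠ [(-1)^k]` (`k` even) — the inert degree-one place over `ℓ` of part 12 has `ord_v(ℓw) = ord_v ℓ` odd.
[cite: Deligne1982HodgeCycles, §4 (1) and Cor. 4.2] [cite: Omeara1963, §63B Example 63:12 and §71D Thm. 71:18] -/
theorem sqrtNeg5Sqrt2_mk_natCast_mul_ne_splitDiscriminantClassCM (hR : R = X ^ 2 + C 30 * X + C 25) {ℓ : ℕ} (hℓ : ℓ.Prime)
    (hS : ℓ % 40 = 17 ∨ ℓ % 40 = 31 ∨ ℓ % 40 = 33 ∨ ℓ % 40 = 39) {w : ℤ} (hw : ¬ (ℓ : ℤ) ∣ w) (qℓ : (realField R)ˣ)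
    (hqℓ : (qℓ : realField R) = (ℓ : realField R) * (w : realField R)) {k : ℕ} (hk : Even k) :
    (QuotientGroup.mk qℓ : cmNormResidueGroup R) ≠ splitDiscriminantClassCM R k := by
  have hnsq : ¬ IsSquare (((2 : ℤ) : ℤ) : ZMod 5) := by decide
  have hp0 : ℓ ≠ 5 := by omega
  haveI := Fact.mk hℓ
  have hroots := roots_real_neg_of_quadratic hR (by norm_num) (by norm_num) (by norm_num)
  have hrel := root_rel_quadratic hR
  push_cast at hrel
  have hℓ0 : (ℓ : realField R) ≠ 0 := by exact_mod_cast hℓ.ne_zero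
  have hne := (sqrtNeg5Sqrt2_mk_prime_ne_splitDiscriminantClassCM_iff_mod hR hℓ (Units.mk0 _ hℓ0) (Units.val_mk0 _)
    even_two).2 hS
  obtain ⟨s, -, hs⟩ := sqrtNeg5Sqrt2_ratPrimeRule_exists_sq_eq_2 hR
  have hs' : s ^ 2 = ((2 : ℤ) : 𝓞 (realField R)) := by rw [hs]; norm_num
  have hb := radicand_places_of_inert (finrank_realField_quadratic hR) hs' Nat.prime_five hnsq hℓ hp0
  have hfac : AdjoinRoot.root (realPolyQ R) = ((-1/2 : realField R) + (-1/10 : realField R) * AdjoinRoot.root (realPolyQ R)) ^ 2 * (((-(5 : ℕ) : ℤ) : 𝓞 (realField R)) : realField R) := by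
    rw [show (((-(5 : ℕ) : ℤ) : 𝓞 (realField R)) : realField R) = ((-(5 : ℕ) : ℤ) : realField R) from
      map_intCast (algebraMap (𝓞 (realField R)) (realField R)) _]
    push_cast
    linear_combination (1/20 : realField R) * hrel
  exact mk_natCast_mul_ne_splitDiscriminantClassCM_of_ne hroots hfac (sqrtNeg5Sqrt2_ratPrimeRule_dyadic_unique hR) hℓ hb
    (Units.mk0 _ hℓ0) (Units.val_mk0 _) even_two hne hw qℓ hqℓ hk

/-- **THE INTEGER ROWS of the `ℚ(√-5,√2)` table**: for `n ≥ 1`, **`[n] = [1] ⟺` every prime `ℓ` with `ℓ % 40 = 17 ∨ ℓ % 40 = 31 ∨ ℓ % 40 = 33 ∨ ℓ % 40 = 39` divides `n`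
to an EVEN power** (part IX-M's induction; no exceptional prime). [cite: Deligne1982HodgeCycles, §4 (1) and Cor. 4.2]
[cite: Landherr1936HermitianForms] -/
theorem sqrtNeg5Sqrt2_natCast_eq_splitDiscriminantClassCM_iff (hR : R = X ^ 2 + C 30 * X + C 25) (n : ℕ) (hn : 1 ≤ n)
    (v : (realField R)ˣ) (hv : (v : realField R) = n) :
    (QuotientGroup.mk v : cmNormResidueGroup R) = splitDiscriminantClassCM R 2 ↔
      ∀ ℓ : ℕ, ℓ.Prime → (ℓ % 40 = 17 ∨ ℓ % 40 = 31 ∨ ℓ % 40 = 33 ∨ ℓ % 40 = 39) → Even (n.factorization ℓ) := by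
  refine (natCast_eq_split_iff_even (fun ℓ ↦ ¬ (ℓ % 40 = 17 ∨ ℓ % 40 = 31 ∨ ℓ % 40 = 33 ∨ ℓ % 40 = 39)) 1 ?_ (fun h ↦ absurd h Nat.not_prime_one) ?_ n hn v
    hv).trans (forall_congr' fun ℓ ↦ forall_congr' fun _ ↦ by simp only [not_not])
  · intro ℓ hℓ hs u hu
    by_contra hne
    exact hs ((sqrtNeg5Sqrt2_mk_prime_ne_splitDiscriminantClassCM_iff_mod hR hℓ u hu even_two).1 hne)
  · intro ℓ hℓ hs _ w hw u hu
    exact sqrtNeg5Sqrt2_mk_natCast_mul_ne_splitDiscriminantClassCM hR hℓ (not_not.1 hs) hw u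
      (by rw [hu, map_mul, map_natCast, map_intCast]) even_two

/-- **ROW STRUCTURE of the `ℚ(√-5,√2)` table**: `[n₁] = [n₂] ⟺` the primes `ℓ` with `ℓ % 40 = 17 ∨ ℓ % 40 = 31 ∨ ℓ % 40 = 33 ∨ ℓ % 40 = 39` occur in `n₁`, `n₂` with
exponents of the same parity. [cite: Deligne1982HodgeCycles, §4 (1) and Cor. 4.2] [cite: Landherr1936HermitianForms] -/
theorem sqrtNeg5Sqrt2_natCast_mk_eq_mk_iff (hR : R = X ^ 2 + C 30 * X + C 25) {n₁ n₂ : ℕ} (hn₁ : 1 ≤ n₁) (hn₂ : 1 ≤ n₂)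
    (u v : (realField R)ˣ) (hu : (u : realField R) = n₁) (hv : (v : realField R) = n₂) :
    (QuotientGroup.mk u : cmNormResidueGroup R) = QuotientGroup.mk v ↔
      ∀ ℓ : ℕ, ℓ.Prime → (ℓ % 40 = 17 ∨ ℓ % 40 = 31 ∨ ℓ % 40 = 33 ∨ ℓ % 40 = 39) → (Even (n₁.factorization ℓ) ↔ Even (n₂.factorization ℓ)) := by
  refine (natCast_mk_eq_mk_iff_even (fun ℓ ↦ ¬ (ℓ % 40 = 17 ∨ ℓ % 40 = 31 ∨ ℓ % 40 = 33 ∨ ℓ % 40 = 39)) 1 ?_ (fun h ↦ absurd h Nat.not_prime_one) ?_ hn₁ hn₂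
    u v hu hv).trans (forall_congr' fun ℓ ↦ forall_congr' fun _ ↦ by simp only [not_not])
  · intro ℓ hℓ hs u hu
    by_contra hne
    exact hs ((sqrtNeg5Sqrt2_mk_prime_ne_splitDiscriminantClassCM_iff_mod hR hℓ u hu even_two).1 hne)
  · intro ℓ hℓ hs _ w hw u hu
    exact sqrtNeg5Sqrt2_mk_natCast_mul_ne_splitDiscriminantClassCM hR hℓ (not_not.1 hs) hw u
      (by rw [hu, map_mul, map_natCast, map_intCast]) even_two

end IsqrtNeg5Sqrt2

/-! ### §79 `E = ℚ(√-2,√5)` (`R = S² + 6S + 4`, `F = ℚ(√5)`): non-split primes `ℓ % 40 = 21 ∨ ℓ % 40 = 29 ∨ ℓ % 40 = 31 ∨ ℓ % 40 = 39` -/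
section IsqrtNeg2Sqrt5
/-- **Cofactor obstruction for `ℚ(√-2,√5)`**: for every non-split prime `ℓ` (`ℓ % 40 = 21 ∨ ℓ % 40 = 29 ∨ ℓ % 40 = 31 ∨ ℓ % 40 = 39`) and every `w ∈ ℤ` with
`ℓ ∤ w`: `[ℓ·w] ≠ [(-1)^k]` (`k` even) — the inert degree-one place over `ℓ` of part 12 has `ord_v(ℓw) = ord_v ℓ` odd.
[cite: Deligne1982HodgeCycles, §4 (1) and Cor. 4.2] [cite: Omeara1963, §63B Example 63:12 and §71D Thm. 71:18] -/
theorem sqrtNeg2Sqrt5_mk_natCast_mul_ne_splitDiscriminantClassCM (hR : R = X ^ 2 + C 6 * X + C 4) {ℓ : ℕ} (hℓ : ℓ.Prime)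
    (hS : ℓ % 40 = 21 ∨ ℓ % 40 = 29 ∨ ℓ % 40 = 31 ∨ ℓ % 40 = 39) {w : ℤ} (hw : ¬ (ℓ : ℤ) ∣ w) (qℓ : (realField R)ˣ)
    (hqℓ : (qℓ : realField R) = (ℓ : realField R) * (w : realField R)) {k : ℕ} (hk : Even k) :
    (QuotientGroup.mk qℓ : cmNormResidueGroup R) ≠ splitDiscriminantClassCM R k := by
  haveI := Fact.mk hℓ
  have hroots := roots_real_neg_of_quadratic hR (by norm_num) (by norm_num) (by norm_num)
  have hrel := root_rel_quadratic hR
  push_cast at hrel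
  have hℓ0 : (ℓ : realField R) ≠ 0 := by exact_mod_cast hℓ.ne_zero
  have hne := (sqrtNeg2Sqrt5_mk_prime_ne_splitDiscriminantClassCM_iff_mod hR hℓ (Units.mk0 _ hℓ0) (Units.val_mk0 _)
    even_two).2 hS
  have hfac : AdjoinRoot.root (realPolyQ R) = -2 * ((1 : realField R) + (1/2 : realField R) * AdjoinRoot.root (realPolyQ R)) ^ 2 := by
    linear_combination (1/2 : realField R) * hrel
  exact mk_natCast_mul_ne_splitDiscriminantClassCM_of_ne_of_root_eq_neg_two_mul_sq hroots hfac
    (sqrtNeg2Sqrt5_ratPrimeRule_dyadic_unique hR) hℓ (Units.mk0 _ hℓ0) (Units.val_mk0 _) even_two hne hw qℓ hqℓ hk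

/-- **THE INTEGER ROWS of the `ℚ(√-2,√5)` table**: for `n ≥ 1`, **`[n] = [1] ⟺` every prime `ℓ` with `ℓ % 40 = 21 ∨ ℓ % 40 = 29 ∨ ℓ % 40 = 31 ∨ ℓ % 40 = 39` divides `n`
to an EVEN power** (part IX-M's induction; no exceptional prime). [cite: Deligne1982HodgeCycles, §4 (1) and Cor. 4.2]
[cite: Landherr1936HermitianForms] -/
theorem sqrtNeg2Sqrt5_natCast_eq_splitDiscriminantClassCM_iff (hR : R = X ^ 2 + C 6 * X + C 4) (n : ℕ) (hn : 1 ≤ n)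
    (v : (realField R)ˣ) (hv : (v : realField R) = n) :
    (QuotientGroup.mk v : cmNormResidueGroup R) = splitDiscriminantClassCM R 2 ↔
      ∀ ℓ : ℕ, ℓ.Prime → (ℓ % 40 = 21 ∨ ℓ % 40 = 29 ∨ ℓ % 40 = 31 ∨ ℓ % 40 = 39) → Even (n.factorization ℓ) := by
  refine (natCast_eq_split_iff_even (fun ℓ ↦ ¬ (ℓ % 40 = 21 ∨ ℓ % 40 = 29 ∨ ℓ % 40 = 31 ∨ ℓ % 40 = 39)) 1 ?_ (fun h ↦ absurd h Nat.not_prime_one) ?_ n hn v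
    hv).trans (forall_congr' fun ℓ ↦ forall_congr' fun _ ↦ by simp only [not_not])
  · intro ℓ hℓ hs u hu
    by_contra hne
    exact hs ((sqrtNeg2Sqrt5_mk_prime_ne_splitDiscriminantClassCM_iff_mod hR hℓ u hu even_two).1 hne)
  · intro ℓ hℓ hs _ w hw u hu
    exact sqrtNeg2Sqrt5_mk_natCast_mul_ne_splitDiscriminantClassCM hR hℓ (not_not.1 hs) hw u
      (by rw [hu, map_mul, map_natCast, map_intCast]) even_two

/-- **ROW STRUCTURE of the `ℚ(√-2,√5)` table**: `[n₁] = [n₂] ⟺` the primes `ℓ` with `ℓ % 40 = 21 ∨ ℓ % 40 = 29 ∨ ℓ % 40 = 31 ∨ ℓ % 40 = 39` occur in `n₁`, `n₂` with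
exponents of the same parity. [cite: Deligne1982HodgeCycles, §4 (1) and Cor. 4.2] [cite: Landherr1936HermitianForms] -/
theorem sqrtNeg2Sqrt5_natCast_mk_eq_mk_iff (hR : R = X ^ 2 + C 6 * X + C 4) {n₁ n₂ : ℕ} (hn₁ : 1 ≤ n₁) (hn₂ : 1 ≤ n₂)
    (u v : (realField R)ˣ) (hu : (u : realField R) = n₁) (hv : (v : realField R) = n₂) :
    (QuotientGroup.mk u : cmNormResidueGroup R) = QuotientGroup.mk v ↔
      ∀ ℓ : ℕ, ℓ.Prime → (ℓ % 40 = 21 ∨ ℓ % 40 = 29 ∨ ℓ % 40 = 31 ∨ ℓ % 40 = 39) → (Even (n₁.factorization ℓ) ↔ Even (n₂.factorization ℓ)) := by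
  refine (natCast_mk_eq_mk_iff_even (fun ℓ ↦ ¬ (ℓ % 40 = 21 ∨ ℓ % 40 = 29 ∨ ℓ % 40 = 31 ∨ ℓ % 40 = 39)) 1 ?_ (fun h ↦ absurd h Nat.not_prime_one) ?_ hn₁ hn₂
    u v hu hv).trans (forall_congr' fun ℓ ↦ forall_congr' fun _ ↦ by simp only [not_not])
  · intro ℓ hℓ hs u hu
    by_contra hne
    exact hs ((sqrtNeg2Sqrt5_mk_prime_ne_splitDiscriminantClassCM_iff_mod hR hℓ u hu even_two).1 hne)
  · intro ℓ hℓ hs _ w hw u hu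
    exact sqrtNeg2Sqrt5_mk_natCast_mul_ne_splitDiscriminantClassCM hR hℓ (not_not.1 hs) hw u
      (by rw [hu, map_mul, map_natCast, map_intCast]) even_two

end IsqrtNeg2Sqrt5

/-! ### §80 `E = ℚ(√-2,√-5)` (`R = S² + 14S + 9`, `F = ℚ(√10)`): non-split primes `ℓ % 40 = 13 ∨ ℓ % 40 = 31 ∨ ℓ % 40 = 37 ∨ ℓ % 40 = 39` -/
section IsqrtNeg2SqrtNeg5
/-- **Cofactor obstruction for `ℚ(√-2,√-5)`**: for every non-split prime `ℓ` (`ℓ % 40 = 13 ∨ ℓ % 40 = 31 ∨ ℓ % 40 = 37 ∨ ℓ % 40 = 39`) and every `w ∈ ℤ` with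
`ℓ ∤ w`: `[ℓ·w] ≠ [(-1)^k]` (`k` even) — the inert degree-one place over `ℓ` of part 12 has `ord_v(ℓw) = ord_v ℓ` odd.
[cite: Deligne1982HodgeCycles, §4 (1) and Cor. 4.2] [cite: Omeara1963, §63B Example 63:12 and §71D Thm. 71:18] -/
theorem sqrtNeg2SqrtNeg5_mk_natCast_mul_ne_splitDiscriminantClassCM (hR : R = X ^ 2 + C 14 * X + C 9) {ℓ : ℕ} (hℓ : ℓ.Prime)
    (hS : ℓ % 40 = 13 ∨ ℓ % 40 = 31 ∨ ℓ % 40 = 37 ∨ ℓ % 40 = 39) {w : ℤ} (hw : ¬ (ℓ : ℤ) ∣ w) (qℓ : (realField R)ˣ)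
    (hqℓ : (qℓ : realField R) = (ℓ : realField R) * (w : realField R)) {k : ℕ} (hk : Even k) :
    (QuotientGroup.mk qℓ : cmNormResidueGroup R) ≠ splitDiscriminantClassCM R k := by
  haveI := Fact.mk hℓ
  have hroots := roots_real_neg_of_quadratic hR (by norm_num) (by norm_num) (by norm_num)
  have hrel := root_rel_quadratic hR
  push_cast at hrel
  have hℓ0 : (ℓ : realField R) ≠ 0 := by exact_mod_cast hℓ.ne_zero
  have hne := (sqrtNeg2SqrtNeg5_mk_prime_ne_splitDiscriminantClassCM_iff_mod hR hℓ (Units.mk0 _ hℓ0) (Units.val_mk0 _)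
    even_two).2 hS
  have hfac : AdjoinRoot.root (realPolyQ R) = -2 * ((-3/4 : realField R) + (-1/4 : realField R) * AdjoinRoot.root (realPolyQ R)) ^ 2 := by
    linear_combination (1/8 : realField R) * hrel
  exact mk_natCast_mul_ne_splitDiscriminantClassCM_of_ne_of_root_eq_neg_two_mul_sq hroots hfac
    (sqrtNeg2SqrtNeg5_ratPrimeRule_dyadic_unique hR) hℓ (Units.mk0 _ hℓ0) (Units.val_mk0 _) even_two hne hw qℓ hqℓ hk

/-- **THE INTEGER ROWS of the `ℚ(√-2,√-5)` table**: for `n ≥ 1`, **`[n] = [1] ⟺` every prime `ℓ` with `ℓ % 40 = 13 ∨ ℓ % 40 = 31 ∨ ℓ % 40 = 37 ∨ ℓ % 40 = 39` divides `n`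
to an EVEN power** (part IX-M's induction; no exceptional prime). [cite: Deligne1982HodgeCycles, §4 (1) and Cor. 4.2]
[cite: Landherr1936HermitianForms] -/
theorem sqrtNeg2SqrtNeg5_natCast_eq_splitDiscriminantClassCM_iff (hR : R = X ^ 2 + C 14 * X + C 9) (n : ℕ) (hn : 1 ≤ n)
    (v : (realField R)ˣ) (hv : (v : realField R) = n) :
    (QuotientGroup.mk v : cmNormResidueGroup R) = splitDiscriminantClassCM R 2 ↔
      ∀ ℓ : ℕ, ℓ.Prime → (ℓ % 40 = 13 ∨ ℓ % 40 = 31 ∨ ℓ % 40 = 37 ∨ ℓ % 40 = 39) → Even (n.factorization ℓ) := by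
  refine (natCast_eq_split_iff_even (fun ℓ ↦ ¬ (ℓ % 40 = 13 ∨ ℓ % 40 = 31 ∨ ℓ % 40 = 37 ∨ ℓ % 40 = 39)) 1 ?_ (fun h ↦ absurd h Nat.not_prime_one) ?_ n hn v
    hv).trans (forall_congr' fun ℓ ↦ forall_congr' fun _ ↦ by simp only [not_not])
  · intro ℓ hℓ hs u hu
    by_contra hne
    exact hs ((sqrtNeg2SqrtNeg5_mk_prime_ne_splitDiscriminantClassCM_iff_mod hR hℓ u hu even_two).1 hne)
  · intro ℓ hℓ hs _ w hw u hu
    exact sqrtNeg2SqrtNeg5_mk_natCast_mul_ne_splitDiscriminantClassCM hR hℓ (not_not.1 hs) hw u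
      (by rw [hu, map_mul, map_natCast, map_intCast]) even_two

/-- **ROW STRUCTURE of the `ℚ(√-2,√-5)` table**: `[n₁] = [n₂] ⟺` the primes `ℓ` with `ℓ % 40 = 13 ∨ ℓ % 40 = 31 ∨ ℓ % 40 = 37 ∨ ℓ % 40 = 39` occur in `n₁`, `n₂` with
exponents of the same parity. [cite: Deligne1982HodgeCycles, §4 (1) and Cor. 4.2] [cite: Landherr1936HermitianForms] -/
theorem sqrtNeg2SqrtNeg5_natCast_mk_eq_mk_iff (hR : R = X ^ 2 + C 14 * X + C 9) {n₁ n₂ : ℕ} (hn₁ : 1 ≤ n₁) (hn₂ : 1 ≤ n₂)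
    (u v : (realField R)ˣ) (hu : (u : realField R) = n₁) (hv : (v : realField R) = n₂) :
    (QuotientGroup.mk u : cmNormResidueGroup R) = QuotientGroup.mk v ↔
      ∀ ℓ : ℕ, ℓ.Prime → (ℓ % 40 = 13 ∨ ℓ % 40 = 31 ∨ ℓ % 40 = 37 ∨ ℓ % 40 = 39) → (Even (n₁.factorization ℓ) ↔ Even (n₂.factorization ℓ)) := by
  refine (natCast_mk_eq_mk_iff_even (fun ℓ ↦ ¬ (ℓ % 40 = 13 ∨ ℓ % 40 = 31 ∨ ℓ % 40 = 37 ∨ ℓ % 40 = 39)) 1 ?_ (fun h ↦ absurd h Nat.not_prime_one) ?_ hn₁ hn₂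
    u v hu hv).trans (forall_congr' fun ℓ ↦ forall_congr' fun _ ↦ by simp only [not_not])
  · intro ℓ hℓ hs u hu
    by_contra hne
    exact hs ((sqrtNeg2SqrtNeg5_mk_prime_ne_splitDiscriminantClassCM_iff_mod hR hℓ u hu even_two).1 hne)
  · intro ℓ hℓ hs _ w hw u hu
    exact sqrtNeg2SqrtNeg5_mk_natCast_mul_ne_splitDiscriminantClassCM hR hℓ (not_not.1 hs) hw u
      (by rw [hu, map_mul, map_natCast, map_intCast]) even_two

end IsqrtNeg2SqrtNeg5

end Summit.HodgeConjecture.HodgeConjecture.Ring2.WeilCoverageCM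

end
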